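import Literature.MathematicalPhysics.QuantumFieldTheory.Balaban1983to89.BlockAveragingEMLProp2
import HarnessLib

/-!
# `BlockPlaquetteOneStepLinearisationCoupled` — ONE AVERAGING STEP OF [Balaban1987RG1] (0.4) WITH `exp[mean log]` ON `SU(N)`: AT ONE COUPLED
# INDEX, THE FIRST-ORDER SUM IS THE TRANSPORTED TRANSLATED `L×L` SQUARE, TO SECOND ORDER (file 1 of 3 of brick (M1))

Cell `ym3-torus` (YM ladder rung R3 = continuum SU(2) Yang–Mills on T³ — a RUNG, NOT the Clay problem: not d = 4, not infinite volume, not a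
mass gap), crux of record `UnitScaleTilt.HistoryTailL` (stmt-QuantumFields-19936), width seat `ym-ust-19936-w2` (gen 14).  Brick **(M1)** of the
crux idea «gross-sd-transfer» (LINE 28 candidate, `Cruxes/HistoryTailL/Ideas/gross-sd-transfer.md`, annex 1 §2 (iv) ∕ §3 «S_lin»; this seat's LOCATE
`LOCATE-LINE28-SLIN-w2g14.md` = 19936 evidence #51; ideator word «w2: GO (M1)» 2026-08-29T16:31:51Z): the FIRST of the four missing pieces of the
linearisation `dist₁(Ū^j(∂a)) = |linear flux functional| + O(·)` on the crux's own types — the AVERAGING step (the Stokes step (b′) is px10 g7's,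
the j-fold induction (M3) and the `log` chart (M4) are later bricks).

WHAT IS PRINTED.  T. Bałaban, *Averaging operations for lattice gauge theories*, Commun. Math. Phys. **98** (1985) 17–51 [Balaban1985Averaging],
p. 25–26, inside the proof of Proposition 1 (51): *«|V̄₀(∂p′) − 1 − i Σ_{c⊂∂p′} Σ_{x∈B(c₋)} L^{−d} A(Γ_{c,x})| < O(1)(L²α₀)² (47)  Denoting by
(p′)_x a plaquette obtained by translation of the plaquette p′ to the point x, we have the identity Σ_{c⊂∂p′} Σ_{x∈B(c₋)} L^{−d} A(Γ_{c,x}) =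
Σ_{x∈B(y₀)} L^{−d} A(∂(p′)_x) (48)»* — the coarse plaquette of the averaged field is, to FIRST order, the block mean of the TRANSLATED COARSE
SQUARES `∂(p′)_x`.  T. Bałaban, *Renormalization group approach to lattice gauge field theories. I*, Commun. Math. Phys. **109** (1987) 249–301
[Balaban1987RG1], (0.3)–(0.4) pp. 252–253 (the symmetric block averaging with all staircase orderings) and p. 253 *«The considerations and
results of this, and previous papers, do not depend on any particular averaging operation used»*.

WHAT THIS FILE PROVES (kernel; 0 `def`, 0 `sorry`; file 1 of 3, one namespace).  The tree module `BlockAveragingEMLProp2` proves Prop. 1 (51) for the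
averaging OF RECORD `avgFun expMeanLogSU` through the coupled-index mechanism: ✓`prod_four_loopHol_eq` (the four COUPLED loop variables at index
`J = (r, σ, τ, ρ, ω)` multiply to `Z·Q⁻¹·Z⁻¹·P₀(J)`, `P₀(J) = T_{r,σ}·U(∂(p′)_{x(r,σ)})·T_{r,σ}⁻¹` the translated coarse square conjugated by the
staircase transporter `T_{r,σ} = U(Γ^σ_{y→x})`) and then BOUNDS `‖P₀(J) − 1‖ ≤ L²a` (✓`coupled_first_order_le_of_atoms`).  Here the same proof is
re-run STOPPING ONE STEP EARLIER:
* §1 private normed-algebra ∕ `SU(N)` letters (products of near-`1` elements to second order, the commutator and inverse-pair letters, the key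
  identity — as in the tree module, which keeps them `private`).
* §2 ★★ `coupled_first_order_sub_transportedSquare_le_of_atoms` — `‖Σₖ(aₖ − 1) + (Q − 1) − (P₀(J) − 1)‖ ≤ 15·s²` (`s = (((d+4)L)²/4)·a`; the
  configuration enters only through the sizes of the atoms: the loop variables at the four bonds of `∂p′`, the transport loop `Z`, the straight
  and the translated coarse squares).
Files 2–3 (`BlockPlaquetteOneStepLinearisation`, `…Readings`) assemble the coarse plaquette `Ū(∂p′)` and record the `dist₁` readings.

HONEST FRAMING.  Deterministic lattice bookkeeping on the tree's own objects; a helper toward an UNREGISTERED idea's stub (S_lin of LINE 28) and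
line-independent infrastructure (also the first-order half of LINE 15's `stub_levelOneLipschitz` Schur bound); `--supports stmt-QuantumFields-19936`.
It proves no stub, crux, rung or summit statement; nothing of Bałaban's beyond the displayed algebra is asserted; S_lin ∕ S_dom ∕
«ShallowFluxSecondMomentL» ∕ (Q) ∕ K1 ∕ `MeanDeviationL` ∕ `HistoryTailL` are NOT proved; the Yang–Mills mass gap is NOT proved.

References: [Balaban1985Averaging] T. Bałaban, CMP 98 (1985) 17–51, (47)–(48) and Prop. 1 (51) pp. 25–26; [Balaban1987RG1] T. Bałaban, CMP 109
(1987) 249–301, (0.3)–(0.4) pp. 252–253.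
-/

noncomputable section

open scoped BigOperators

namespace Summit.QuantumFields.YangMills.Theorems.BlockPlaquetteOneStepLinearisation

open Literature.MathematicalPhysics.QuantumFieldTheory.Balaban1983to89
open Literature.MathematicalPhysics.QuantumFieldTheory.Balaban1983to89.BlockAveragingEMLProp2

/-! ## §1 Private letters (as in the tree module `BlockAveragingEMLProp2`, which keeps them private) -/

section Algebra

variable {𝔸 : Type*} [NormedRing 𝔸]

/-- `‖∏ xᵢ − 1‖ ≤ (1+b)^n − 1` for a list of `n` elements within `b` of `1`. [folklore] -/
private theorem norm_prod_sub_one_le (b : ℝ) (hb : 0 ≤ b) :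
    ∀ l : List 𝔸, (∀ x ∈ l, ‖x - 1‖ ≤ b) → ‖l.prod - 1‖ ≤ (1 + b) ^ l.length - 1
  | [], _ => by simp
  | x :: l, h => by
    have hx : ‖x - 1‖ ≤ b := h x (by simp)
    have ih := norm_prod_sub_one_le b hb l fun y hy => h y (by simp [hy])
    have hP : 0 ≤ (1 + b) ^ l.length - 1 := by
      have : (1 : ℝ) ≤ (1 + b) ^ l.length := one_le_pow₀ (by linarith)
      linarith
    rw [List.prod_cons, List.length_cons]
    have e : x * l.prod - 1 = (x - 1) * (l.prod - 1) + (x - 1) + (l.prod - 1) := by noncomm_ring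
    rw [e]
    calc ‖(x - 1) * (l.prod - 1) + (x - 1) + (l.prod - 1)‖
        ≤ ‖x - 1‖ * ‖l.prod - 1‖ + ‖x - 1‖ + ‖l.prod - 1‖ :=
          (norm_add_le _ _).trans (add_le_add ((norm_add_le _ _).trans (add_le_add (norm_mul_le _ _) le_rfl)) le_rfl)
      _ ≤ b * ((1 + b) ^ l.length - 1) + b + ((1 + b) ^ l.length - 1) := by gcongr
      _ = (1 + b) ^ (l.length + 1) - 1 := by ring

/-- Products of near-`1` elements to second order: `‖∏ xᵢ − 1 − Σ (xᵢ − 1)‖ ≤ (1+b)^n − 1 − n·b`. [folklore] -/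
private theorem norm_prod_sub_one_sub_sum_le (b : ℝ) (hb : 0 ≤ b) :
    ∀ l : List 𝔸, (∀ x ∈ l, ‖x - 1‖ ≤ b) →
      ‖l.prod - 1 - (l.map (· - 1)).sum‖ ≤ (1 + b) ^ l.length - 1 - l.length * b
  | [], _ => by simp
  | x :: l, h => by
    have hx : ‖x - 1‖ ≤ b := h x (by simp)
    have h' : ∀ y ∈ l, ‖y - 1‖ ≤ b := fun y hy => h y (by simp [hy])
    have ih := norm_prod_sub_one_sub_sum_le b hb l h'
    have ih₁ := norm_prod_sub_one_le b hb l h'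
    rw [List.prod_cons, List.length_cons, List.map_cons, List.sum_cons]
    have e : x * l.prod - 1 - ((x - 1) + (l.map (· - 1)).sum) =
        (x - 1) * (l.prod - 1) + (l.prod - 1 - (l.map (· - 1)).sum) := by noncomm_ring
    rw [e]
    calc ‖(x - 1) * (l.prod - 1) + (l.prod - 1 - (l.map (· - 1)).sum)‖
        ≤ ‖x - 1‖ * ‖l.prod - 1‖ + ‖l.prod - 1 - (l.map (· - 1)).sum‖ :=
          (norm_add_le _ _).trans (add_le_add (norm_mul_le _ _) le_rfl)
      _ ≤ b * ((1 + b) ^ l.length - 1) + ((1 + b) ^ l.length - 1 - l.length * b) := by gcongr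
      _ = (1 + b) ^ (l.length + 1) - 1 - ((l.length + 1 : ℕ) : ℝ) * b := by push_cast; ring

/-- Five factors: `‖x₁x₂x₃x₄x₅ − 1 − Σ(xᵢ − 1)‖ ≤ 26b²` when every `‖xᵢ − 1‖ ≤ b ≤ 1`. [folklore] -/
private theorem norm_prod_five_sub_le {x₁ x₂ x₃ x₄ x₅ : 𝔸} {b : ℝ} (hb : 0 ≤ b) (hb1 : b ≤ 1)
    (h₁ : ‖x₁ - 1‖ ≤ b) (h₂ : ‖x₂ - 1‖ ≤ b) (h₃ : ‖x₃ - 1‖ ≤ b) (h₄ : ‖x₄ - 1‖ ≤ b) (h₅ : ‖x₅ - 1‖ ≤ b) :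
    ‖x₁ * x₂ * x₃ * x₄ * x₅ - 1 - ((x₁ - 1) + (x₂ - 1) + (x₃ - 1) + (x₄ - 1) + (x₅ - 1))‖ ≤ 26 * b ^ 2 := by
  have h := norm_prod_sub_one_sub_sum_le b hb [x₁, x₂, x₃, x₄, x₅] (by simp [h₁, h₂, h₃, h₄, h₅])
  simp only [List.prod_cons, List.prod_nil, mul_one, List.map_cons, List.map_nil, List.sum_cons, List.sum_nil,
    add_zero, List.length_cons, List.length_nil] at h
  have e : (1 + b) ^ (0 + 1 + 1 + 1 + 1 + 1) - 1 - ((0 + 1 + 1 + 1 + 1 + 1 : ℕ) : ℝ) * b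
      = b ^ 2 * (10 + 10 * b + 5 * b ^ 2 + b ^ 3) := by push_cast; ring
  rw [e] at h
  have hb' : b ^ 2 * (10 + 10 * b + 5 * b ^ 2 + b ^ 3) ≤ 26 * b ^ 2 := by
    have h26 : 10 + 10 * b + 5 * b ^ 2 + b ^ 3 ≤ 26 := by nlinarith [sq_nonneg b, mul_nonneg hb (sq_nonneg b)]
    nlinarith [sq_nonneg b]
  simpa [mul_assoc, add_assoc] using h.trans hb'

/-- Four factors: `‖x₁x₂x₃x₄ − 1 − Σ(xᵢ − 1)‖ ≤ 11b²` when every `‖xᵢ − 1‖ ≤ b ≤ 1`. [folklore] -/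
private theorem norm_prod_four_sub_le {x₁ x₂ x₃ x₄ : 𝔸} {b : ℝ} (hb : 0 ≤ b) (hb1 : b ≤ 1)
    (h₁ : ‖x₁ - 1‖ ≤ b) (h₂ : ‖x₂ - 1‖ ≤ b) (h₃ : ‖x₃ - 1‖ ≤ b) (h₄ : ‖x₄ - 1‖ ≤ b) :
    ‖x₁ * x₂ * x₃ * x₄ - 1 - ((x₁ - 1) + (x₂ - 1) + (x₃ - 1) + (x₄ - 1))‖ ≤ 11 * b ^ 2 := by
  have h := norm_prod_sub_one_sub_sum_le b hb [x₁, x₂, x₃, x₄] (by simp [h₁, h₂, h₃, h₄])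
  simp only [List.prod_cons, List.prod_nil, mul_one, List.map_cons, List.map_nil, List.sum_cons, List.sum_nil,
    add_zero, List.length_cons, List.length_nil] at h
  have e : (1 + b) ^ (0 + 1 + 1 + 1 + 1) - 1 - ((0 + 1 + 1 + 1 + 1 : ℕ) : ℝ) * b
      = b ^ 2 * (6 + 4 * b + b ^ 2) := by push_cast; ring
  rw [e] at h
  have hb' : b ^ 2 * (6 + 4 * b + b ^ 2) ≤ 11 * b ^ 2 := by
    have h11 : 6 + 4 * b + b ^ 2 ≤ 11 := by nlinarith [sq_nonneg b]
    nlinarith [sq_nonneg b]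
  simpa [mul_assoc, add_assoc] using h.trans hb'

/-- Commutator of near-`1` elements: `‖z q w − q‖ ≤ 2‖z − 1‖·‖q − 1‖` when `z w = 1`, `‖w‖ ≤ 1`. [folklore] -/
private theorem norm_conj_sub_self_le {z w q : 𝔸} (hzw : z * w = 1) (hw : ‖w‖ ≤ 1) :
    ‖z * q * w - q‖ ≤ 2 * ‖z - 1‖ * ‖q - 1‖ := by
  have e : z * q * w - q = ((z - 1) * (q - 1) - (q - 1) * (z - 1)) * w := by
    have h1 : z * q * w - q = z * q * w - q * (z * w) := by rw [hzw, mul_one]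
    rw [h1]
    noncomm_ring
  rw [e]
  calc ‖((z - 1) * (q - 1) - (q - 1) * (z - 1)) * w‖ ≤ ‖(z - 1) * (q - 1) - (q - 1) * (z - 1)‖ * ‖w‖ := norm_mul_le _ _
    _ ≤ (‖z - 1‖ * ‖q - 1‖ + ‖q - 1‖ * ‖z - 1‖) * 1 := by
        gcongr
        exact (norm_sub_le _ _).trans (add_le_add (norm_mul_le _ _) (norm_mul_le _ _))
    _ = 2 * ‖z - 1‖ * ‖q - 1‖ := by ring

/-- An inverse pair to second order: `‖(w − 1) + (q − 1)‖ ≤ ‖q − 1‖²` when `w q = 1`, `‖w‖ ≤ 1`. [folklore] -/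
private theorem norm_inv_add_self_sub_two_le {w q : 𝔸} (hwq : w * q = 1) (hw : ‖w‖ ≤ 1) :
    ‖(w - 1) + (q - 1)‖ ≤ ‖q - 1‖ ^ 2 := by
  have e : (w - 1) + (q - 1) = w * ((q - 1) * (q - 1)) := by
    have : w * ((q - 1) * (q - 1)) = (w * q) * q - 2 * (w * q) + w := by noncomm_ring
    rw [this, hwq]; noncomm_ring
  rw [e]
  calc ‖w * ((q - 1) * (q - 1))‖ ≤ ‖w‖ * (‖q - 1‖ * ‖q - 1‖) :=
        (norm_mul_le _ _).trans (mul_le_mul_of_nonneg_left (norm_mul_le _ _) (norm_nonneg _))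
    _ ≤ 1 * (‖q - 1‖ * ‖q - 1‖) := by gcongr
    _ = ‖q - 1‖ ^ 2 := by ring

/-- The key identity to second order: if `Π = (z q′ w) P₀` with `z w = 1`, `q′ q = 1` and `‖w‖, ‖P₀‖, ‖q′‖ ≤ 1`, then
`‖(Π − 1) + (q − 1) − (P₀ − 1)‖ ≤ 2‖z − 1‖‖q′ − 1‖ + ‖q′ − 1‖‖P₀ − 1‖ + ‖q − 1‖²`. [folklore] -/
private theorem norm_key_identity_le {z w q q' P₀ : 𝔸} (hzw : z * w = 1) (hw : ‖w‖ ≤ 1) (hq : q' * q = 1) (hq' : ‖q'‖ ≤ 1)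
    (hP₀ : ‖P₀‖ ≤ 1) :
    ‖(z * q' * w * P₀ - 1) + (q - 1) - (P₀ - 1)‖ ≤
      2 * ‖z - 1‖ * ‖q' - 1‖ + ‖q' - 1‖ * ‖P₀ - 1‖ + ‖q - 1‖ ^ 2 := by
  have e : (z * q' * w * P₀ - 1) + (q - 1) - (P₀ - 1) =
      (z * q' * w - q') * P₀ + (q' - 1) * (P₀ - 1) + ((q' - 1) + (q - 1)) := by noncomm_ring
  rw [e]
  calc ‖(z * q' * w - q') * P₀ + (q' - 1) * (P₀ - 1) + ((q' - 1) + (q - 1))‖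
      ≤ ‖(z * q' * w - q') * P₀‖ + ‖(q' - 1) * (P₀ - 1)‖ + ‖(q' - 1) + (q - 1)‖ :=
        (norm_add_le _ _).trans (add_le_add (norm_add_le _ _) le_rfl)
    _ ≤ (2 * ‖z - 1‖ * ‖q' - 1‖) * 1 + ‖q' - 1‖ * ‖P₀ - 1‖ + ‖q - 1‖ ^ 2 := by
        gcongr
        · exact (norm_mul_le _ _).trans (mul_le_mul (norm_conj_sub_self_le hzw hw) hP₀ (norm_nonneg _)
            (by positivity))
        · exact norm_mul_le _ _
        · exact norm_inv_add_self_sub_two_le hq hq'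
    _ = _ := by ring

end Algebra

/-! ## §2 The coupled first-order sum at one index IS the transported translated square, to second order -/

section Coupled

open T4Continuum BlockAveraging AveragingRT ExpMeanLog LatticeWordStokes B10Eq47AxialChi NormedSpace
open scoped Matrix.Norms.L2Operator

variable {n : Type*} [Fintype n] [DecidableEq n] [Nonempty n] {P : Params} {j : ℕ}
omit [Nonempty n] in
/-- Elements of `SU(N)` are unitary matrices. [folklore] -/
private theorem coe_mem_unitaryGroup (g : Matrix.specialUnitaryGroup n ℂ) : (g : Matrix n n ℂ) ∈ Matrix.unitaryGroup n ℂ :=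
  (Matrix.mem_specialUnitaryGroup_iff.1 g.2).1

omit [Nonempty n] in
/-- `g · g* = 1` for `g ∈ SU(N)`. [folklore] -/
private theorem coe_mul_star_self (g : Matrix.specialUnitaryGroup n ℂ) : (g : Matrix n n ℂ) * star (g : Matrix n n ℂ) = 1 :=
  Unitary.mul_star_self_of_mem (coe_mem_unitaryGroup g)

omit [Nonempty n] in
/-- `g* · g = 1` for `g ∈ SU(N)`. [folklore] -/
private theorem coe_star_mul_self (g : Matrix.specialUnitaryGroup n ℂ) : star (g : Matrix n n ℂ) * (g : Matrix n n ℂ) = 1 :=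
  Unitary.star_mul_self_of_mem (coe_mem_unitaryGroup g)

omit [Nonempty n] in
/-- The inverse in `SU(N)` is the conjugate transpose (coercion lemma). [folklore] -/
private theorem coe_inv_eq_star (g : Matrix.specialUnitaryGroup n ℂ) :
    ((g⁻¹ : Matrix.specialUnitaryGroup n ℂ) : Matrix n n ℂ) = star (g : Matrix n n ℂ) := rfl

omit [Nonempty n] in
/-- `g*` is unitary for `g ∈ SU(N)`. [folklore] -/
private theorem star_coe_mem_unitaryGroup (g : Matrix.specialUnitaryGroup n ℂ) : star (g : Matrix n n ℂ) ∈ Matrix.unitaryGroup n ℂ :=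
  coe_mem_unitaryGroup g⁻¹

/-- `‖g‖ = 1` (operator norm) for `g ∈ SU(N)`. [folklore] -/
private theorem norm_coe_eq_one (g : Matrix.specialUnitaryGroup n ℂ) : ‖(g : Matrix n n ℂ)‖ = 1 :=
  CStarRing.norm_of_mem_unitary (coe_mem_unitaryGroup g)

omit [Nonempty n] in
/-- `uXw − 1 = u(X − 1)w` when `uw = 1`. [folklore] -/
private theorem conj_sub_one {u w X : Matrix n n ℂ} (h : u * w = 1) : u * X * w - 1 = u * (X - 1) * w := by
  rw [mul_sub, sub_mul, mul_one, h]
-- hb: measured FAIL at maxHeartbeats 100000 (whnf in the four-factor assembly ∕ `nlinarith`), PASS at the default 200000; decl-local budget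
-- per cell README (heartbeat rule) — never file-global.
set_option maxHeartbeats 400000 in
/-- **THE COUPLED FIRST-ORDER SUM AT ONE INDEX IS THE TRANSPORTED TRANSLATED SQUARE, TO SECOND ORDER (atomised form).**  For the coupled
index `(r, σ, τ, ρ, ω)` of the coarse plaquette `p′ = ⟨y; μ < ν⟩`, with `a₁ = W¹`, `a₂ = S₁W²S₁⁻¹`, `a₃ = S₄(W³)⁻¹S₄⁻¹`, `a₄ = (W⁴)⁻¹` the four coupled
(0.4) loop variables of ✓`prod_four_loopHol_eq`, `Q` the straight coarse plaquette and `P₀ = T_{r,σ}·U(∂(p′)_{x(r,σ)})·T_{r,σ}⁻¹` the translated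
coarse square conjugated by the staircase transporter: `‖Σₖ(aₖ − 1) + (Q − 1) − (P₀ − 1)‖ ≤ 15·s²`, `s = (((d+4)L)²/4)·a`, the configuration entering
only through the sizes of the atoms (loop variables at the four bonds within `(((d+2)L)²/4)·a`, transport loop `Z` within `s`, the two squares within
`L²a`), `s ≤ ⅙`.  The tree's ✓`coupled_first_order_le_of_atoms` is this estimate followed by `‖P₀ − 1‖ ≤ L²a`. [cite: Balaban1985Averaging, (47)-(48) and Prop. 1 (51) pp.25-26; Balaban1987RG1, (0.3)-(0.4) pp.252-253] -/
theorem coupled_first_order_sub_transportedSquare_le_of_atoms {a : ℝ} (ha : 0 ≤ a) {U : GaugeField P j (Matrix.specialUnitaryGroup n ℂ)}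
    (hs6 : ((((P.d + 4) * P.L : ℕ) : ℝ) ^ 2 / 4) * a ≤ 1 / 6)
    (y : Site P (j + 1)) {μ ν : Fin P.d} (hμν : μ < ν) (r : Fin P.d → Fin P.L) (σ τ ρ ω : Equiv.Perm (Fin P.d))
    (hW₁ : ∀ i, dist1 (loopHol U ⟨y, μ⟩ i) ≤ ((((P.d + 2) * P.L : ℕ) : ℝ) ^ 2 / 4) * a)
    (hW₂ : ∀ i, dist1 (loopHol U ⟨y.shift μ, ν⟩ i) ≤ ((((P.d + 2) * P.L : ℕ) : ℝ) ^ 2 / 4) * a)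
    (hW₃ : ∀ i, dist1 (loopHol U ⟨y.shift ν, μ⟩ i) ≤ ((((P.d + 2) * P.L : ℕ) : ℝ) ^ 2 / 4) * a)
    (hW₄ : ∀ i, dist1 (loopHol U ⟨y, ν⟩ i) ≤ ((((P.d + 2) * P.L : ℕ) : ℝ) ^ 2 / 4) * a)
    (hZ : dist1 (holAt U (walk (emb y) (stairWord σ (off r) ++ (List.replicate P.L (μ, true) ++ (List.replicate P.L (ν, true) ++
        (wordRev (stairWord ρ (off r)) ++ (List.replicate P.L (ν, false) ++ List.replicate P.L (μ, false)))))))) ≤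
      ((((P.d + 4) * P.L : ℕ) : ℝ) ^ 2 / 4) * a)
    (hsq : dist1 (rect U (emb y) μ ν P.L P.L) ≤ (P.L : ℝ) ^ 2 * a)
    (hsqσ : dist1 (rect U (walkEnd (emb y) (stairWord σ (off r))) μ ν P.L P.L) ≤ (P.L : ℝ) ^ 2 * a) :
    ‖(((loopHol U ⟨y, μ⟩ (r, σ, τ) : Matrix.specialUnitaryGroup n ℂ) : Matrix n n ℂ) - 1) +
        (((axialAvg U ⟨y, μ⟩ : Matrix.specialUnitaryGroup n ℂ) : Matrix n n ℂ) *
          (((loopHol U ⟨y.shift μ, ν⟩ (r, τ, ρ) : Matrix.specialUnitaryGroup n ℂ) : Matrix n n ℂ) - 1) *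
          star ((axialAvg U ⟨y, μ⟩ : Matrix.specialUnitaryGroup n ℂ) : Matrix n n ℂ)) +
        (((axialAvg U ⟨y, ν⟩ : Matrix.specialUnitaryGroup n ℂ) : Matrix n n ℂ) *
          (star (((loopHol U ⟨y.shift ν, μ⟩ (r, ω, ρ) : Matrix.specialUnitaryGroup n ℂ) : Matrix n n ℂ)) - 1) *
          star ((axialAvg U ⟨y, ν⟩ : Matrix.specialUnitaryGroup n ℂ) : Matrix n n ℂ)) +
        (star (((loopHol U ⟨y, ν⟩ (r, σ, ω) : Matrix.specialUnitaryGroup n ℂ) : Matrix n n ℂ)) - 1) +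
        (((GaugeField.plaqHol (axialAvg U) ⟨y, μ, ν, hμν⟩ : Matrix.specialUnitaryGroup n ℂ) : Matrix n n ℂ) - 1) -
        (((holAt U (walk (emb y) (stairWord σ (off r))) * rect U (walkEnd (emb y) (stairWord σ (off r))) μ ν P.L P.L *
            (holAt U (walk (emb y) (stairWord σ (off r))))⁻¹ : Matrix.specialUnitaryGroup n ℂ) : Matrix n n ℂ) - 1)‖ ≤
      15 * (((((P.d + 4) * P.L : ℕ) : ℝ) ^ 2 / 4) * a) ^ 2 := by
  -- adapted from lit `BlockAveragingEMLProp2.coupled_first_order_le_of_atoms` (same atoms; the translated square is kept, not bounded)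
  set s : ℝ := ((((P.d + 4) * P.L : ℕ) : ℝ) ^ 2 / 4) * a with hs_def
  set u : ℝ := (P.L : ℝ) ^ 2 * a with hu_def
  have hs0 : 0 ≤ s := by positivity
  have hu0 : 0 ≤ u := by positivity
  have hus : u ≤ s := by
    rw [hs_def, hu_def]
    have hd : (0 : ℝ) ≤ P.d := Nat.cast_nonneg _
    have : (P.L : ℝ) ^ 2 ≤ (((P.d + 4) * P.L : ℕ) : ℝ) ^ 2 / 4 := by
      push_cast
      nlinarith [sq_nonneg (P.L : ℝ), mul_nonneg hd (sq_nonneg (P.L : ℝ)), mul_nonneg (mul_nonneg hd hd) (sq_nonneg (P.L : ℝ))]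
    exact mul_le_mul_of_nonneg_right this ha
  have hθs : ((((P.d + 2) * P.L : ℕ) : ℝ) ^ 2 / 4) * a ≤ s := by
    rw [hs_def]
    apply mul_le_mul_of_nonneg_right _ ha
    apply div_le_div_of_nonneg_right _ (by norm_num)
    exact_mod_cast Nat.pow_le_pow_left (Nat.mul_le_mul_right P.L (by omega : P.d + 2 ≤ P.d + 4)) 2
  have hs1 : s ≤ 1 := hs6.trans (by norm_num)
  -- the atoms
  set W₁ := loopHol U ⟨y, μ⟩ (r, σ, τ)
  set W₂ := loopHol U ⟨y.shift μ, ν⟩ (r, τ, ρ)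
  set W₃ := loopHol U ⟨y.shift ν, μ⟩ (r, ω, ρ)
  set W₄ := loopHol U ⟨y, ν⟩ (r, σ, ω)
  set S₁ := axialAvg U ⟨y, μ⟩
  set S₄ := axialAvg U ⟨y, ν⟩
  set Qp := GaugeField.plaqHol (axialAvg U) ⟨y, μ, ν, hμν⟩
  set Z := holAt U (walk (emb y) (stairWord σ (off r) ++ (List.replicate P.L (μ, true) ++ (List.replicate P.L (ν, true) ++
        (wordRev (stairWord ρ (off r)) ++ (List.replicate P.L (ν, false) ++ List.replicate P.L (μ, false)))))))
  have hQ : dist1 Qp ≤ u := by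
    show dist1 (GaugeField.plaqHol (axialAvg U) ⟨y, μ, ν, hμν⟩) ≤ u
    rw [plaqHol_axialAvg_eq_rect']
    exact hsq
  -- the group identity, cast to matrices with the translated square kept atomic
  have hid := prod_four_loopHol_eq U y hμν r σ τ ρ ω
  generalize hP : holAt U (walk (emb y) (stairWord σ (off r))) * rect U (walkEnd (emb y) (stairWord σ (off r))) μ ν P.L P.L *
      (holAt U (walk (emb y) (stairWord σ (off r))))⁻¹ = P₀ at hid ⊢
  have hP₀ : dist1 P₀ ≤ u := by rw [← hP, GaugeGroup.dist1_conj]; exact hsqσ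
  have hidM := congrArg (fun g : Matrix.specialUnitaryGroup n ℂ => (g : Matrix n n ℂ)) hid
  simp only [Submonoid.coe_mul, coe_inv_eq_star] at hidM
  -- the four-factor expansion
  have h1 : ‖((W₁ : Matrix.specialUnitaryGroup n ℂ) : Matrix n n ℂ) - 1‖ ≤ s := by
    rw [← FederbushMean.dist1_SU_eq]; exact (hW₁ _).trans hθs
  have h2 : ‖(S₁ : Matrix n n ℂ) * ((W₂ : Matrix.specialUnitaryGroup n ℂ) : Matrix n n ℂ) * star (S₁ : Matrix n n ℂ) - 1‖ ≤ s := by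
    rw [norm_conj_sub_one_eq (coe_mem_unitaryGroup S₁) (star_coe_mem_unitaryGroup S₁) (coe_mul_star_self S₁), ← FederbushMean.dist1_SU_eq]
    exact (hW₂ _).trans hθs
  have h3 : ‖(S₄ : Matrix n n ℂ) * star ((W₃ : Matrix.specialUnitaryGroup n ℂ) : Matrix n n ℂ) * star (S₄ : Matrix n n ℂ) - 1‖
      ≤ s := by
    rw [norm_conj_sub_one_eq (coe_mem_unitaryGroup S₄) (star_coe_mem_unitaryGroup S₄) (coe_mul_star_self S₄), norm_star_sub_one,
      ← FederbushMean.dist1_SU_eq]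
    exact (hW₃ _).trans hθs
  have h4 : ‖star ((W₄ : Matrix.specialUnitaryGroup n ℂ) : Matrix n n ℂ) - 1‖ ≤ s := by
    rw [norm_star_sub_one, ← FederbushMean.dist1_SU_eq]; exact (hW₄ _).trans hθs
  have hfour := norm_prod_four_sub_le hs0 hs1 h1 h2 h3 h4
  rw [hidM] at hfour
  -- the key identity
  have hkey := norm_key_identity_le (z := ((Z : Matrix.specialUnitaryGroup n ℂ) : Matrix n n ℂ))
    (w := star ((Z : Matrix.specialUnitaryGroup n ℂ) : Matrix n n ℂ))
    (q := ((Qp : Matrix.specialUnitaryGroup n ℂ) : Matrix n n ℂ)) (q' := star ((Qp : Matrix.specialUnitaryGroup n ℂ) : Matrix n n ℂ))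
    (P₀ := ((P₀ : Matrix.specialUnitaryGroup n ℂ) : Matrix n n ℂ))
    (coe_mul_star_self Z) (by rw [← coe_inv_eq_star, norm_coe_eq_one]) (coe_star_mul_self Qp)
    (by rw [← coe_inv_eq_star, norm_coe_eq_one]) (by rw [norm_coe_eq_one])
  have hz : ‖((Z : Matrix.specialUnitaryGroup n ℂ) : Matrix n n ℂ) - 1‖ ≤ s := by rw [← FederbushMean.dist1_SU_eq]; exact hZ
  have hq : ‖((Qp : Matrix.specialUnitaryGroup n ℂ) : Matrix n n ℂ) - 1‖ ≤ u := by rw [← FederbushMean.dist1_SU_eq]; exact hQ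
  have hq' : ‖star ((Qp : Matrix.specialUnitaryGroup n ℂ) : Matrix n n ℂ) - 1‖ ≤ u := by rw [norm_star_sub_one]; exact hq
  have hp : ‖((P₀ : Matrix.specialUnitaryGroup n ℂ) : Matrix n n ℂ) - 1‖ ≤ u := by rw [← FederbushMean.dist1_SU_eq]; exact hP₀
  have hsec : 2 * ‖((Z : Matrix.specialUnitaryGroup n ℂ) : Matrix n n ℂ) - 1‖ * ‖star ((Qp : Matrix.specialUnitaryGroup n ℂ) :
      Matrix n n ℂ) - 1‖ + ‖star ((Qp : Matrix.specialUnitaryGroup n ℂ) : Matrix n n ℂ) - 1‖ *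
      ‖((P₀ : Matrix.specialUnitaryGroup n ℂ) : Matrix n n ℂ) - 1‖ + ‖((Qp : Matrix.specialUnitaryGroup n ℂ) : Matrix n n ℂ) - 1‖ ^ 2
      ≤ 4 * s ^ 2 := by
    have hz0 := norm_nonneg (((Z : Matrix.specialUnitaryGroup n ℂ) : Matrix n n ℂ) - 1)
    have hq0 := norm_nonneg (star ((Qp : Matrix.specialUnitaryGroup n ℂ) : Matrix n n ℂ) - 1)
    have hp0 := norm_nonneg (((P₀ : Matrix.specialUnitaryGroup n ℂ) : Matrix n n ℂ) - 1)
    have hq00 := norm_nonneg (((Qp : Matrix.specialUnitaryGroup n ℂ) : Matrix n n ℂ) - 1)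
    nlinarith [mul_le_mul hz hq' hq0 hs0, mul_le_mul hq' hp hp0 hu0, mul_le_mul hq hq hq00 hu0, mul_le_mul hus hus hu0 hs0,
      mul_le_mul_of_nonneg_left hus hs0]
  -- conjugation forms of the pieces
  have e2 : (S₁ : Matrix n n ℂ) * (((W₂ : Matrix.specialUnitaryGroup n ℂ) : Matrix n n ℂ) - 1) * star (S₁ : Matrix n n ℂ) =
      (S₁ : Matrix n n ℂ) * ((W₂ : Matrix.specialUnitaryGroup n ℂ) : Matrix n n ℂ) * star (S₁ : Matrix n n ℂ) - 1 :=
    (conj_sub_one (coe_mul_star_self S₁)).symm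
  have e3 : (S₄ : Matrix n n ℂ) * (star ((W₃ : Matrix.specialUnitaryGroup n ℂ) : Matrix n n ℂ) - 1) * star (S₄ : Matrix n n ℂ) =
      (S₄ : Matrix n n ℂ) * star ((W₃ : Matrix.specialUnitaryGroup n ℂ) : Matrix n n ℂ) * star (S₄ : Matrix n n ℂ) - 1 :=
    (conj_sub_one (coe_mul_star_self S₄)).symm
  rw [e2, e3]
  -- assemble (the translated square `P₀` is subtracted, not bounded)
  have etot : (((W₁ : Matrix.specialUnitaryGroup n ℂ) : Matrix n n ℂ) - 1) +
      ((S₁ : Matrix n n ℂ) * ((W₂ : Matrix.specialUnitaryGroup n ℂ) : Matrix n n ℂ) * star (S₁ : Matrix n n ℂ) - 1) +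
      ((S₄ : Matrix n n ℂ) * star ((W₃ : Matrix.specialUnitaryGroup n ℂ) : Matrix n n ℂ) * star (S₄ : Matrix n n ℂ) - 1) +
      (star ((W₄ : Matrix.specialUnitaryGroup n ℂ) : Matrix n n ℂ) - 1) +
      (((Qp : Matrix.specialUnitaryGroup n ℂ) : Matrix n n ℂ) - 1) -
      (((P₀ : Matrix.specialUnitaryGroup n ℂ) : Matrix n n ℂ) - 1) =
    -(((Z : Matrix.specialUnitaryGroup n ℂ) : Matrix n n ℂ) * star ((Qp : Matrix.specialUnitaryGroup n ℂ) : Matrix n n ℂ) *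
        star ((Z : Matrix.specialUnitaryGroup n ℂ) : Matrix n n ℂ) * ((P₀ : Matrix.specialUnitaryGroup n ℂ) : Matrix n n ℂ) - 1 -
        ((((W₁ : Matrix.specialUnitaryGroup n ℂ) : Matrix n n ℂ) - 1) +
          ((S₁ : Matrix n n ℂ) * ((W₂ : Matrix.specialUnitaryGroup n ℂ) : Matrix n n ℂ) * star (S₁ : Matrix n n ℂ) - 1) +
          ((S₄ : Matrix n n ℂ) * star ((W₃ : Matrix.specialUnitaryGroup n ℂ) : Matrix n n ℂ) * star (S₄ : Matrix n n ℂ) - 1) +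
          (star ((W₄ : Matrix.specialUnitaryGroup n ℂ) : Matrix n n ℂ) - 1))) +
      ((((Z : Matrix.specialUnitaryGroup n ℂ) : Matrix n n ℂ) * star ((Qp : Matrix.specialUnitaryGroup n ℂ) : Matrix n n ℂ) *
        star ((Z : Matrix.specialUnitaryGroup n ℂ) : Matrix n n ℂ) * ((P₀ : Matrix.specialUnitaryGroup n ℂ) : Matrix n n ℂ) - 1) +
        (((Qp : Matrix.specialUnitaryGroup n ℂ) : Matrix n n ℂ) - 1) - (((P₀ : Matrix.specialUnitaryGroup n ℂ) : Matrix n n ℂ) - 1)) := by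
    abel
  rw [etot]
  refine (norm_add_le _ _).trans ((add_le_add ((norm_neg _).trans_le hfour) hkey).trans ?_)
  nlinarith [hsec]

end Coupled
end Summit.QuantumFields.YangMills.Theorems.BlockPlaquetteOneStepLinearisation

end
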